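import Summits.QuantumFields.YangMills.Theorems.EquipartitionCriticalityEquipartitionPinsProbeTangentEnergyAlgebra
import Mathlib.Analysis.SpecialFunctions.Exponential
import HarnessLib

/-!
# The action side of the single-link Stein identity (stub TS4 of line `Sketch`)

Crux `stmt-QuantumFields-8760` (`EquipartitionPinsProbe`), line `Sketch`, stub
`stub_shiftDerivAction`. For a lattice representation `r` of a compact group `G`, a frame vector
`e_b = lieVec r b` and a curve `k : ℝ → G` with `ρ(k_t) = exp(t e_b)`, we differentiate at `t = 0`
the boundary Wilson action `S_{e}(U) = ∑_{q ∋ e} (N − Re tr ρ(U_q))` of a single edge `e = (x, i)`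
along the two shift families of the Stein identity,

* left:  `U_e ↦ G_U(x)⁻¹ k_t G_U(x) U_e`,
* right: `U_e ↦ U_e G_U(x + eᵢ)⁻¹ k_t⁻¹ G_U(x + eᵢ)`,

`G_U` the comb transport (`…TangentDefs`), and show that `√β` times the derivative equals
`± ∑_{q ∋ e} dδ_e(q) Y_q^b` up to `3 √β ∑_{q ∋ e} ∑_a (N − Re tr ρ(Ũ_{∂_a q}))`, where
`Y = plaqField r β U` is the rescaled plaquette field and `Ũ = axialFix U`.

Proof.
* Gauge invariance of the boundary action under the comb gauge `G_U` of the UNSHIFTED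
  configuration turns the two families into `Ũ_e ↦ k_t Ũ_e`, resp. `Ũ_e ↦ Ũ_e k_t⁻¹`
  (`gauge_update_left/right`); no comb transport of the shifted configuration is needed.
* For a plaquette `q ∋ e` the shifted link occurs exactly once in the plaquette word; conjugating
  cyclically (and inverting the word when the link enters inversely, `Re tr ρ(g⁻¹) = Re tr ρ(g)`)
  gives `Re tr ρ(hol_q(t)) = Re tr(exp(t e_b) ρ(g₀g₁g₂g₃))` for a signed cyclic rotation
  `g₀g₁g₂g₃` of the word `Ũ₀Ũ₁Ũ₂⁻¹Ũ₃⁻¹` (`plaquette_deriv`, eight cases closed by `group`).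
* `d/dt|₀ Re tr(exp(tX) W) = Re tr(X W)` (Mathlib `hasDerivAt_exp_smul_const'` in the Frobenius
  normed algebra `M_N(ℂ)`), and `−Re tr(e_b W) = lieCoord r (W − 1) b` (skew-Hermitian frame).
* The first-order algebra `|∑ c(ρ(g_i) − 1) − c(ρ(g₀g₁g₂g₃) − 1)| ≤ 3 ∑ (N − Re tr ρ(g_i))`
  (`abs_sum_sub_prod_le`, the telescoping of `…TangentEnergyAlgebra` with permuted factors), with
  `c(ρ(g⁻¹) − 1) = −c(ρ(g) − 1)`, identifies the linear term with `± dδ_e(q) · Y_q^b / √β`.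
* Summation over `plaquettesTouching {e}` (`assemble`).

References: S. Chatterjee, arXiv:1602.01222, §§9–11 (axial gauge, first-order expansion);
B. C. Hall, GTM 222 (2015), Thm. 3.20.
-/

noncomputable section

open scoped Matrix Matrix.Norms.Frobenius
open NormedSpace
open Literature.Probability.LatticeModels Literature.MathematicalPhysics.QuantumLattice
open Literature.MathematicalPhysics.QuantumFieldTheory

namespace Summit.QuantumFields.YangMills.Theorems.EquipartitionPinsProbe

namespace TangentShiftDerivAction

/-! ### Matrix calculus -/

section MatrixCalculus

variable {N : ℕ}

/-- `d/dt|₀ Re tr(exp(tX) W) = Re tr(X W)` in `M_N(ℂ)`, the real parameter `t` entering through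
`(t : ℂ) • X` (Mathlib `hasDerivAt_exp_smul_const'` over `ℝ`, then the continuous real-linear
functional `M ↦ Re tr(M W)`). [folklore] -/
theorem hasDerivAt_re_trace_exp_mul (X W : Matrix (Fin N) (Fin N) ℂ) :
    HasDerivAt (fun u : ℝ => (exp ((u : ℂ) • X) * W).trace.re) ((X * W).trace.re) 0 := by
  have h' := hasDerivAt_exp_smul_const' (𝕂 := ℝ) X (0 : ℝ)
  have h0 : HasDerivAt (fun u : ℝ => exp ((u : ℂ) • X)) (X * exp (((0 : ℝ) : ℂ) • X)) 0 := by
    simp only [Complex.coe_smul]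
    exact h'
  have h := h0.mul_const W
  rw [Complex.ofReal_zero, zero_smul, exp_zero, mul_one] at h
  let L : Matrix (Fin N) (Fin N) ℂ →L[ℝ] ℝ := LinearMap.toContinuousLinearMap
    (Complex.reLm.comp ((Matrix.traceLinearMap (Fin N) ℂ ℂ).restrictScalars ℝ))
  exact L.hasFDerivAt.comp_hasDerivAt (0 : ℝ) h

end MatrixCalculus

/-! ### Frame coordinates and the first-order algebra -/

section Rep

variable {G : Type} [Group G] [TopologicalSpace G] (r : LatticeRep G)

/-- `lieCoord r M a = −Re tr(e_a M)` (the frame is skew-Hermitian; cyclicity of the trace). [folklore] -/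
theorem lieCoord_eq_neg_re_trace (M : Matrix (Fin r.N) (Fin r.N) ℂ) (a : Fin (lieDim r)) :
    lieCoord r M a = -(lieVec r a * M).trace.re := by
  have hE : (lieVec r a)ᴴ = -lieVec r a := FreeEnergyLogCoefficient.conjTranspose_lieIso r.ρ _
  rw [lieCoord, hE, Matrix.mul_neg, Matrix.trace_neg, Complex.neg_re, Matrix.trace_mul_comm]

/-- The identity matrix has vanishing frame coordinates: `Re tr(e_a†) = 0`. [folklore] -/
theorem lieCoord_one (a : Fin (lieDim r)) : lieCoord r 1 a = 0 := by
  have h := TangentEnergyAlgebra.lieCoord_conjTranspose r 1 a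
  rw [Matrix.conjTranspose_one] at h
  linarith

/-- For unitary-valued `ρ`: `c(ρ(g⁻¹) − 1) = −c(ρ(g) − 1)` (`ρ(g⁻¹) = ρ(g)†`). [folklore] -/
theorem lieCoord_map_inv_sub_one (g : G) (a : Fin (lieDim r)) :
    lieCoord r (r.ρ g⁻¹ - 1) a = -lieCoord r (r.ρ g - 1) a := by
  rw [TangentCombPoincare.map_inv_eq_conjTranspose r.ρ r.mem_unitary,
    ← TangentEnergyAlgebra.lieCoord_conjTranspose, Matrix.conjTranspose_sub, Matrix.conjTranspose_one]

/-- **The first-order algebra for an arbitrary fourfold product of unitaries**: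
`|∑ c(A_i − 1) − c(A₀A₁A₂A₃ − 1)| ≤ 3 ∑ (N − Re tr A_i)`, `c = lieCoord r · a`
(telescoping, `|c(R)| ≤ ‖R‖_F`, `‖A − 1‖_F² = 2(N − Re tr A)`). [folklore] -/
theorem abs_sum_sub_prod_le (a : Fin (lieDim r)) {A₀ A₁ A₂ A₃ : Matrix (Fin r.N) (Fin r.N) ℂ}
    (h₀ : A₀ ∈ Matrix.unitaryGroup (Fin r.N) ℂ) (h₁ : A₁ ∈ Matrix.unitaryGroup (Fin r.N) ℂ)
    (h₂ : A₂ ∈ Matrix.unitaryGroup (Fin r.N) ℂ) (h₃ : A₃ ∈ Matrix.unitaryGroup (Fin r.N) ℂ) :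
    |lieCoord r (A₀ - 1) a + lieCoord r (A₁ - 1) a + lieCoord r (A₂ - 1) a +
          lieCoord r (A₃ - 1) a - lieCoord r (A₀ * A₁ * A₂ * A₃ - 1) a| ≤
      3 * (((r.N : ℝ) - A₀.trace.re) + ((r.N : ℝ) - A₁.trace.re) + ((r.N : ℝ) - A₂.trace.re) +
        ((r.N : ℝ) - A₃.trace.re)) := by
  simp only [← TangentEnergyAlgebra.lieCoord_add, ← TangentEnergyAlgebra.lieCoord_sub]
  rw [TangentEnergyAlgebra.sum_sub_prod_four, TangentEnergyAlgebra.lieCoord_neg, abs_neg]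
  refine (TangentEnergyAlgebra.abs_lieCoord_le r _ a).trans
    ((TangentEnergyAlgebra.norm_remainder_le h₀ h₁ _ _).trans ?_)
  exact TangentEnergyAlgebra.real_bound (TangentCombPoincare.norm_sub_one_sq h₀)
    (TangentCombPoincare.norm_sub_one_sq h₁) (TangentCombPoincare.norm_sub_one_sq h₂)
    (TangentCombPoincare.norm_sub_one_sq h₃)

/-- `Re tr ρ` of a conjugate. [folklore] -/
theorem re_trace_eq_of_eq_conj {a g : G} (h : G) (ha : a = h * g * h⁻¹) :
    (r.ρ a).trace.re = (r.ρ g).trace.re := by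
  rw [ha]; exact TangentCombPoincare.re_trace_map_conj r.ρ h g

/-- `Re tr ρ` of an element whose inverse is a conjugate (`Re tr ρ(a⁻¹) = Re tr ρ(a)`). [folklore] -/
theorem re_trace_eq_of_inv_eq_conj {a g : G} (h : G) (ha : a⁻¹ = h * g * h⁻¹) :
    (r.ρ a).trace.re = (r.ρ g).trace.re := by
  rw [← TangentCombPoincare.re_trace_map_inv r.ρ r.mem_unitary a, ha]
  exact TangentCombPoincare.re_trace_map_conj r.ρ h g

/-- **Master lemma**: if `Re tr ρ(F t) = Re tr ρ(k_t g₀g₁g₂g₃)` with `ρ(k_t) = exp(t e_b)`, then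
`t ↦ N − Re tr ρ(F t)` has derivative `D = c(ρ(g₀g₁g₂g₃) − 1)` at `0`, and
`|D − ∑ c(ρ(g_i) − 1)| ≤ 3 ∑ (N − Re tr ρ(g_i))`; stated in continuation form (`hAB`) so that the
caller's target bound is produced directly. [folklore] -/
theorem master (b : Fin (lieDim r)) {k : ℝ → G}
    (hk : ∀ t : ℝ, r.ρ (k t) = exp ((t : ℂ) • lieVec r b)) (g₀ g₁ g₂ g₃ : G) {F : ℝ → G}
    (hF : ∀ t, (r.ρ (F t)).trace.re = (r.ρ (k t * (g₀ * g₁ * g₂ * g₃))).trace.re) {A B : ℝ}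
    (hAB : ∀ D : ℝ, |D - (lieCoord r (r.ρ g₀ - 1) b + lieCoord r (r.ρ g₁ - 1) b +
        lieCoord r (r.ρ g₂ - 1) b + lieCoord r (r.ρ g₃ - 1) b)| ≤
      3 * (((r.N : ℝ) - (r.ρ g₀).trace.re) + ((r.N : ℝ) - (r.ρ g₁).trace.re) +
        ((r.N : ℝ) - (r.ρ g₂).trace.re) + ((r.N : ℝ) - (r.ρ g₃).trace.re)) → |D + A| ≤ B) :
    ∃ D : ℝ, HasDerivAt (fun t => (r.N : ℝ) - (r.ρ (F t)).trace.re) D 0 ∧ |D + A| ≤ B := by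
  refine ⟨lieCoord r (r.ρ (g₀ * g₁ * g₂ * g₃) - 1) b, ?_, hAB _ ?_⟩
  · have hfun : (fun t => (r.N : ℝ) - (r.ρ (F t)).trace.re) = fun t : ℝ =>
        (r.N : ℝ) - (exp ((t : ℂ) • lieVec r b) * r.ρ (g₀ * g₁ * g₂ * g₃)).trace.re := by
      funext t; rw [hF t, map_mul, hk]
    rw [hfun, TangentEnergyAlgebra.lieCoord_sub, lieCoord_one, sub_zero, lieCoord_eq_neg_re_trace]
    exact (hasDerivAt_re_trace_exp_mul (lieVec r b) _).const_sub (r.N : ℝ)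
  · rw [abs_sub_comm, map_mul, map_mul, map_mul]
    exact abs_sum_sub_prod_le r b (r.mem_unitary _) (r.mem_unitary _) (r.mem_unitary _)
      (r.mem_unitary _)

/-! ### The single plaquette -/

/-- A unit step changes the site. [folklore] -/
theorem ne_add_single (x : Site 4) (k : Fin 4) : x ≠ x + Pi.single k 1 := by
  intro h
  have h' := congr_fun h k
  simp at h'

/-- **The single-plaquette computation** (both families): for a plaquette `q ∋ e` of a
configuration `V`, the derivative at `t = 0` of `N − Re tr ρ(hol_q)` under `V_e ↦ k_t V_e`
(resp. `V_e ↦ V_e k_t⁻¹`) lies within `3 ∑_a (N − Re tr ρ(V_{∂_a q}))` of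
`+dδ_e(q) · curl(c(ρ(V) − 1))(q)` (resp. `−` it): in each of the four positions of `e` in `∂q` it is
the frame coordinate of a signed cyclic rotation of the plaquette word (`master`). [folklore] -/
theorem plaquette_deriv (b : Fin (lieDim r)) {k : ℝ → G}
    (hk : ∀ t : ℝ, r.ρ (k t) = exp ((t : ℂ) • lieVec r b)) (V : LGConfig 4 G)
    (e : Literature.MathematicalPhysics.QuantumLattice.ZdEdge 4) (q : ZdPlaquette 4)
    (hq : e ∈ plaquetteEdges q) :
    (∃ D : ℝ, HasDerivAt (fun t => (r.N : ℝ) - plaquetteObs r.ρ q.1 q.2.1.1 q.2.1.2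
        (Function.update V e (k t * V e))) D 0 ∧
      |D + (-1) * (plaquetteCurl (fun e' => if e' = e then (1 : ℝ) else 0) q *
          plaquetteCurl (fun e' => lieCoord r (r.ρ (V e') - 1) b) q)| ≤
        3 * ∑ a : Fin 4, ((r.N : ℝ) - (r.ρ (V (plaquetteBoundary q a))).trace.re)) ∧
    (∃ D : ℝ, HasDerivAt (fun t => (r.N : ℝ) - plaquetteObs r.ρ q.1 q.2.1.1 q.2.1.2
        (Function.update V e (V e * (k t)⁻¹))) D 0 ∧
      |D + 1 * (plaquetteCurl (fun e' => if e' = e then (1 : ℝ) else 0) q *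
          plaquetteCurl (fun e' => lieCoord r (r.ρ (V e') - 1) b) q)| ≤
        3 * ∑ a : Fin 4, ((r.N : ℝ) - (r.ρ (V (plaquetteBoundary q a))).trace.re)) := by
  obtain ⟨x, ⟨i, j⟩, hij⟩ := q
  have hne : i ≠ j := ne_of_lt hij
  have n01 : (x, i) ≠ (x + Pi.single i 1, j) := fun h => hne (Prod.ext_iff.1 h).2
  have n02 : (x, i) ≠ (x + Pi.single j 1, i) := fun h =>
    ne_add_single x j (Prod.ext_iff.1 h).1
  have n03 : (x, i) ≠ (x, j) := fun h => hne (Prod.ext_iff.1 h).2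
  have n12 : (x + Pi.single i 1, j) ≠ (x + Pi.single j 1, i) := fun h =>
    hne.symm (Prod.ext_iff.1 h).2
  have n13 : (x + Pi.single i 1, j) ≠ (x, j) := fun h =>
    ne_add_single x i (Prod.ext_iff.1 h).1.symm
  have n23 : (x + Pi.single j 1, i) ≠ (x, j) := fun h => hne (Prod.ext_iff.1 h).2
  have hinv := TangentCombPoincare.re_trace_map_inv r.ρ r.mem_unitary
  simp only [plaquetteEdges, Finset.mem_insert, Finset.mem_singleton] at hq
  simp only [plaquetteObs, plaquetteCurl_eq, Fin.sum_univ_four, plaquetteBoundary, Matrix.cons_val]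
  -- substitute the position of `e`, evaluate the indicator curl and the updated plaquette word
  rcases hq with rfl | rfl | rfl | rfl <;>
    simp only [if_true, if_false, n01, n02, n03, n12, n13, n23, n01.symm, n02.symm, n03.symm,
      n12.symm, n13.symm, n23.symm, plaquetteHolonomyZd, Function.update_self,
      Function.update_of_ne, ne_eq, not_false_eq_true]
  · -- position 0, `e = (x, i)`: words `k V₀V₁V₂⁻¹V₃⁻¹` and (inverted) `k V₀⁻¹V₃V₂V₁⁻¹`
    refine ⟨master r b hk (V (x, i)) (V (x + Pi.single i 1, j)) (V (x + Pi.single j 1, i))⁻¹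
        (V (x, j))⁻¹ (fun t => re_trace_eq_of_eq_conj r 1 (by group)) fun D hbd => ?_,
      master r b hk (V (x, i))⁻¹ (V (x, j)) (V (x + Pi.single j 1, i))
        (V (x + Pi.single i 1, j))⁻¹ (fun t => re_trace_eq_of_inv_eq_conj r
          (V (x, j) * V (x + Pi.single j 1, i) * (V (x + Pi.single i 1, j))⁻¹) (by group))
        fun D hbd => ?_⟩ <;>
    · simp only [lieCoord_map_inv_sub_one, hinv] at hbd
      rw [abs_le] at hbd ⊢; constructor <;> linarith [hbd.1, hbd.2]
  · -- position 1, `e = (x + eᵢ, j)`: words `k V₁V₂⁻¹V₃⁻¹V₀` and (inverted) `k V₁⁻¹V₀⁻¹V₃V₂`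
    refine ⟨master r b hk (V (x + Pi.single i 1, j)) (V (x + Pi.single j 1, i))⁻¹ (V (x, j))⁻¹
        (V (x, i)) (fun t => re_trace_eq_of_eq_conj r (V (x, i)) (by group)) fun D hbd => ?_,
      master r b hk (V (x + Pi.single i 1, j))⁻¹ (V (x, i))⁻¹ (V (x, j))
        (V (x + Pi.single j 1, i)) (fun t => re_trace_eq_of_inv_eq_conj r
          (V (x, j) * V (x + Pi.single j 1, i)) (by group)) fun D hbd => ?_⟩ <;>
    · simp only [lieCoord_map_inv_sub_one, hinv] at hbd
      rw [abs_le] at hbd ⊢; constructor <;> linarith [hbd.1, hbd.2]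
  · -- position 2, `e = (x + eⱼ, i)`: (inverted) `k V₂V₁⁻¹V₀⁻¹V₃` and `k V₂⁻¹V₃⁻¹V₀V₁`
    refine ⟨master r b hk (V (x + Pi.single j 1, i)) (V (x + Pi.single i 1, j))⁻¹ (V (x, i))⁻¹
        (V (x, j)) (fun t => re_trace_eq_of_inv_eq_conj r (V (x, j)) (by group)) fun D hbd => ?_,
      master r b hk (V (x + Pi.single j 1, i))⁻¹ (V (x, j))⁻¹ (V (x, i))
        (V (x + Pi.single i 1, j)) (fun t => re_trace_eq_of_eq_conj r
          (V (x, i) * V (x + Pi.single i 1, j)) (by group)) fun D hbd => ?_⟩ <;>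
    · simp only [lieCoord_map_inv_sub_one, hinv] at hbd
      rw [abs_le] at hbd ⊢; constructor <;> linarith [hbd.1, hbd.2]
  · -- position 3, `e = (x, j)`: (inverted) `k V₃V₂V₁⁻¹V₀⁻¹` and `k V₃⁻¹V₀V₁V₂⁻¹`
    refine ⟨master r b hk (V (x, j)) (V (x + Pi.single j 1, i)) (V (x + Pi.single i 1, j))⁻¹
        (V (x, i))⁻¹ (fun t => re_trace_eq_of_inv_eq_conj r 1 (by group)) fun D hbd => ?_,
      master r b hk (V (x, j))⁻¹ (V (x, i)) (V (x + Pi.single i 1, j))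
        (V (x + Pi.single j 1, i))⁻¹ (fun t => re_trace_eq_of_eq_conj r
          (V (x, i) * V (x + Pi.single i 1, j) * (V (x + Pi.single j 1, i))⁻¹) (by group))
        fun D hbd => ?_⟩ <;>
    · simp only [lieCoord_map_inv_sub_one, hinv] at hbd
      rw [abs_le] at hbd ⊢; constructor <;> linarith [hbd.1, hbd.2]

/-- A plaquette touching `{e}` has `e` among its edges. [folklore] -/
theorem mem_plaquetteEdges_of_mem {e : Literature.MathematicalPhysics.QuantumLattice.ZdEdge 4}
    {q : ZdPlaquette 4}
    (hq : q ∈ plaquettesTouching ({e} : Finset (Literature.MathematicalPhysics.QuantumLattice.ZdEdge 4))) :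
    e ∈ plaquetteEdges q := by
  obtain ⟨e', he'⟩ := mem_plaquettesTouching_iff.1 hq
  rw [Finset.mem_inter, Finset.mem_singleton] at he'
  exact he'.2 ▸ he'.1

end Rep

/-! ### Summation and the gauge reduction -/

/-- **Summation over plaquettes** (abstract): term derivatives `D_q` with `|D_q + s d_q L_q| ≤ 3 T_q`
sum to a derivative `D` of `∑_q f_q` with `|c D + s ∑_q d_q (c L_q)| ≤ 3 c ∑_q T_q` for `c ≥ 0`
(here `c = √β`, `d_q = dδ_e(q)`, `c L_q = Y_q^b`). [folklore] -/
theorem assemble {ι : Type} (S : Finset ι) {c : ℝ} (hc : 0 ≤ c) (s : ℝ) (f : ι → ℝ → ℝ)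
    (d L T : ι → ℝ)
    (h : ∀ q ∈ S, ∃ D : ℝ, HasDerivAt (f q) D 0 ∧ |D + s * (d q * L q)| ≤ 3 * T q) :
    ∃ D : ℝ, HasDerivAt (fun t => ∑ q ∈ S, f q t) D 0 ∧
      |c * D + s * ∑ q ∈ S, d q * (c * L q)| ≤ 3 * c * ∑ q ∈ S, T q := by
  choose! Dq hDq using h
  refine ⟨∑ q ∈ S, Dq q, HasDerivAt.fun_sum fun q hq => (hDq q hq).1, ?_⟩
  have key : ∀ q ∈ S, |c * Dq q + s * (d q * (c * L q))| ≤ c * (3 * T q) := fun q hq => by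
    rw [show c * Dq q + s * (d q * (c * L q)) = c * (Dq q + s * (d q * L q)) by ring, abs_mul,
      abs_of_nonneg hc]
    exact mul_le_mul_of_nonneg_left (hDq q hq).2 hc
  calc |c * ∑ q ∈ S, Dq q + s * ∑ q ∈ S, d q * (c * L q)|
      = |∑ q ∈ S, (c * Dq q + s * (d q * (c * L q)))| := by
        rw [Finset.sum_add_distrib, ← Finset.mul_sum, ← Finset.mul_sum]
    _ ≤ ∑ q ∈ S, |c * Dq q + s * (d q * (c * L q))| := Finset.abs_sum_le_sum_abs _ _
    _ ≤ ∑ q ∈ S, c * (3 * T q) := Finset.sum_le_sum key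
    _ = 3 * c * ∑ q ∈ S, T q := by rw [← Finset.mul_sum, ← Finset.mul_sum]; ring

section Gauge

variable {G : Type} [Group G]

/-- The left family is a comb-gauge transform of a left shift of the gauge-fixed configuration:
`(U with U_e ↦ G_U(x)⁻¹ g G_U(x) U_e)^{G_U} = (Ũ with Ũ_e ↦ g Ũ_e)`. [folklore] -/
theorem gauge_update_left (U : LGConfig 4 G) (e : Literature.MathematicalPhysics.QuantumLattice.ZdEdge 4)
    (g : G) :
    gaugeTransformZd (combTransport U)
        (Function.update U e ((combTransport U e.1)⁻¹ * g * combTransport U e.1 * U e)) =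
      Function.update (axialFix U) e (g * axialFix U e) := by
  funext e'
  by_cases h : e' = e
  · subst h
    simp only [gaugeTransformZd, Function.update_self, CombBasics.axialFix_apply]; group
  · simp only [gaugeTransformZd, Function.update_of_ne h, CombBasics.axialFix_apply]

/-- The right family is a comb-gauge transform of a right shift of the gauge-fixed configuration:
`(U with U_e ↦ U_e G_U(x+eᵢ)⁻¹ g G_U(x+eᵢ))^{G_U} = (Ũ with Ũ_e ↦ Ũ_e g)`. [folklore] -/
theorem gauge_update_right (U : LGConfig 4 G) (e : Literature.MathematicalPhysics.QuantumLattice.ZdEdge 4)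
    (g : G) :
    gaugeTransformZd (combTransport U) (Function.update U e
        (U e * ((combTransport U (e.1 + Pi.single e.2 1))⁻¹ * g *
          combTransport U (e.1 + Pi.single e.2 1)))) =
      Function.update (axialFix U) e (axialFix U e * g) := by
  funext e'
  by_cases h : e' = e
  · subst h
    simp only [gaugeTransformZd, Function.update_self, CombBasics.axialFix_apply]; group
  · simp only [gaugeTransformZd, Function.update_of_ne h, CombBasics.axialFix_apply]

end Gauge

end TangentShiftDerivAction

open TangentShiftDerivAction in
/-- STUB TS4 of line `Sketch` (crux `stmt-QuantumFields-8760`) — **the action side of the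
single-link Stein identity**: for a curve `k_t` in `G` with `ρ(k_t) = exp(t e_b)`, the boundary
Wilson action of `{e}` along the left shift `U_e ↦ G_U(x)⁻¹ k_t G_U(x) U_e` (resp. the right shift
`U_e ↦ U_e G_U(x+eᵢ)⁻¹ k_t⁻¹ G_U(x+eᵢ)`) is differentiable at `t = 0`, and `√β` times its derivative
is `+∑_q dδ_e(q) Y_q^b` (resp. `−` it) up to `K √β ∑_q ∑_a (N − Re tr ρ(Ũ_{∂_a q}))`, `K = 3`, for
all `β`, `U`, `e` (the comb-edge / sign hypotheses of the two clauses are not needed). Gauge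
invariance moves the shift onto `Ũ = axialFix U` (`gauge_update_left/right`); per plaquette the
derivative is the frame coordinate of a signed cyclic rotation of the plaquette word
(`plaquette_deriv`), and the first-order algebra is `abs_sum_sub_prod_le`. [folklore] -/
theorem stub_shiftDerivAction :
    ∀ (G : Type) [Group G] [TopologicalSpace G] [IsTopologicalGroup G] [CompactSpace G]
      (r : Literature.MathematicalPhysics.QuantumFieldTheory.LatticeRep G) (b : Fin (Summit.QuantumFields.YangMills.Theorems.EquipartitionPinsProbe.lieDim r)) (k : ℝ → G),
      (∀ t : ℝ, r.ρ (k t) = NormedSpace.exp ((t : ℂ) • Summit.QuantumFields.YangMills.Theorems.EquipartitionPinsProbe.lieVec r b)) →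
      ∃ K : ℝ, ∀ (β : ℝ) (U : Literature.MathematicalPhysics.QuantumLattice.LGConfig 4 G) (e : Literature.MathematicalPhysics.QuantumLattice.ZdEdge 4),
        (((¬ ∀ j : Fin 4, e.2 < j → e.1 j = 0) ∨ 0 ≤ e.1 e.2) → ∃ D : ℝ,
          HasDerivAt (fun t : ℝ => Literature.MathematicalPhysics.QuantumLattice.wilsonBoundaryAction r.ρ {e} (Function.update U e
              ((Summit.QuantumFields.YangMills.Theorems.EquipartitionPinsProbe.combTransport U e.1)⁻¹ * k t * Summit.QuantumFields.YangMills.Theorems.EquipartitionPinsProbe.combTransport U e.1 * U e))) D 0 ∧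
          |Real.sqrt β * D - ∑ q ∈ Literature.MathematicalPhysics.QuantumLattice.plaquettesTouching {e},
              Literature.MathematicalPhysics.QuantumFieldTheory.plaquetteCurl (fun e' => if e' = e then (1 : ℝ) else 0) q * Summit.QuantumFields.YangMills.Theorems.EquipartitionPinsProbe.plaqField r β U q b| ≤
            K * Real.sqrt β * ∑ q ∈ Literature.MathematicalPhysics.QuantumLattice.plaquettesTouching {e}, ∑ i : Fin 4,
              ((r.N : ℝ) - (r.ρ (Summit.QuantumFields.YangMills.Theorems.EquipartitionPinsProbe.axialFix U (Literature.MathematicalPhysics.QuantumFieldTheory.plaquetteBoundary q i))).trace.re)) ∧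
        ((∀ j : Fin 4, e.2 < j → e.1 j = 0) → e.1 e.2 < 0 → ∃ D : ℝ,
          HasDerivAt (fun t : ℝ => Literature.MathematicalPhysics.QuantumLattice.wilsonBoundaryAction r.ρ {e} (Function.update U e
              (U e * ((Summit.QuantumFields.YangMills.Theorems.EquipartitionPinsProbe.combTransport U (e.1 + Pi.single e.2 1))⁻¹ * (k t)⁻¹ *
                Summit.QuantumFields.YangMills.Theorems.EquipartitionPinsProbe.combTransport U (e.1 + Pi.single e.2 1))))) D 0 ∧
          |Real.sqrt β * D + ∑ q ∈ Literature.MathematicalPhysics.QuantumLattice.plaquettesTouching {e},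
              Literature.MathematicalPhysics.QuantumFieldTheory.plaquetteCurl (fun e' => if e' = e then (1 : ℝ) else 0) q * Summit.QuantumFields.YangMills.Theorems.EquipartitionPinsProbe.plaqField r β U q b| ≤
            K * Real.sqrt β * ∑ q ∈ Literature.MathematicalPhysics.QuantumLattice.plaquettesTouching {e}, ∑ i : Fin 4,
              ((r.N : ℝ) - (r.ρ (Summit.QuantumFields.YangMills.Theorems.EquipartitionPinsProbe.axialFix U (Literature.MathematicalPhysics.QuantumFieldTheory.plaquetteBoundary q i))).trace.re)) := by
  intro G _ _ _ _ r b k hk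
  refine ⟨3, fun β U e => ?_⟩
  set S := plaquettesTouching ({e} : Finset (Literature.MathematicalPhysics.QuantumLattice.ZdEdge 4))
  -- `Y_q^b = √β L_q`, `L_q` the curl of the link coordinates `c(ρ(Ũ_·) − 1)`
  have hY : ∀ p : ZdPlaquette 4, plaqField r β U p b =
      Real.sqrt β * plaquetteCurl (fun e' => lieCoord r (r.ρ (axialFix U e') - 1) b) p := fun p => by
    simp only [plaqField, linkField, plaquetteCurl, Finset.mul_sum]
    exact Finset.sum_congr rfl fun i _ => by ring
  have hsum : ∑ q ∈ S, plaquetteCurl (fun e' => if e' = e then (1 : ℝ) else 0) q * plaqField r β U q b =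
      ∑ q ∈ S, plaquetteCurl (fun e' => if e' = e then (1 : ℝ) else 0) q *
        (Real.sqrt β * plaquetteCurl (fun e' => lieCoord r (r.ρ (axialFix U e') - 1) b) q) :=
    Finset.sum_congr rfl fun q _ => by rw [hY]
  -- summation over `S` of single-plaquette derivatives, for a sign `s` and a family `C`
  have key := fun (s : ℝ) (C : ℝ → LGConfig 4 G) => assemble S (Real.sqrt_nonneg β) s
    (fun q t => (r.N : ℝ) - plaquetteObs r.ρ q.1 q.2.1.1 q.2.1.2 (C t))
    (fun q => plaquetteCurl (fun e' => if e' = e then (1 : ℝ) else 0) q)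
    (fun q => plaquetteCurl (fun e' => lieCoord r (r.ρ (axialFix U e') - 1) b) q)
    (fun q => ∑ a : Fin 4, ((r.N : ℝ) - (r.ρ (axialFix U (plaquetteBoundary q a))).trace.re))
  refine ⟨fun _ => ?_, fun _ _ => ?_⟩
  · -- the left family, `s = -1`
    obtain ⟨D, hD, hbd⟩ := key (-1) (fun t => Function.update (axialFix U) e (k t * axialFix U e))
      fun q hq => (plaquette_deriv r b hk (axialFix U) e q (mem_plaquetteEdges_of_mem hq)).1
    refine ⟨D, ?_, ?_⟩
    · have hfun : (fun t : ℝ => wilsonBoundaryAction r.ρ {e} (Function.update U e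
          ((combTransport U e.1)⁻¹ * k t * combTransport U e.1 * U e))) = fun t =>
          wilsonBoundaryAction r.ρ {e} (Function.update (axialFix U) e (k t * axialFix U e)) :=
        funext fun t => by rw [← gauge_update_left, wilsonBoundaryAction_gaugeTransformZd]
      rw [hfun]; exact hD
    · rw [hsum, sub_eq_add_neg, ← neg_one_mul]; exact hbd
  · -- the right family, `s = 1`
    obtain ⟨D, hD, hbd⟩ := key 1 (fun t => Function.update (axialFix U) e (axialFix U e * (k t)⁻¹))
      fun q hq => (plaquette_deriv r b hk (axialFix U) e q (mem_plaquetteEdges_of_mem hq)).2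
    refine ⟨D, ?_, ?_⟩
    · have hfun : (fun t : ℝ => wilsonBoundaryAction r.ρ {e} (Function.update U e
          (U e * ((combTransport U (e.1 + Pi.single e.2 1))⁻¹ * (k t)⁻¹ *
            combTransport U (e.1 + Pi.single e.2 1))))) = fun t =>
          wilsonBoundaryAction r.ρ {e} (Function.update (axialFix U) e (axialFix U e * (k t)⁻¹)) :=
        funext fun t => by rw [← gauge_update_right, wilsonBoundaryAction_gaugeTransformZd]
      rw [hfun]; exact hD
    · rw [hsum, ← one_mul (∑ q ∈ S, _)]; exact hbd

end Summit.QuantumFields.YangMills.Theorems.EquipartitionPinsProbe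

end
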